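import Literature.MathematicalPhysics.QuantumFieldTheory.OSRegularisedDensity
import HarnessLib

/-!
# The holomorphic density of the skeleton distribution with a free Gaussian window and explicit bound

Topic `Literature/MathematicalPhysics/QuantumFieldTheory`; supplement to `OSRegularisedDensity`. There
the window of the logarithmic-slot engine is `b = 1` and the bound of the density is existential.
For the temperedness estimate (4.5) of Osterwalder–Schrader II, Thm. 4.1 — the inverse-power
dependence of `|S_k(ξ)|` on the minimal time gap — the window must be adapted to the point
(`b ~ 1 / |log gap|`, so that the sector factor `e^{2b∑(log wⱼ)²}` and the slot constants
`e^{M²/(8b)}` are powers of the gap), and the bound must be explicit. This file re-runs the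
construction with a free window `b > 0` (`regFW`, `regGW`, `regCW`, with the same proofs) and
records the **explicit form** of the main theorem: for a given index `a₀` of mass one, the density
`H` of the skeleton distribution near `x₀` obeys
`‖H z‖ ≤ deconvBound (admSplit ê hli) (regCW b …) a₀ ((d+M)(k+2)) r`
(`exists_holomorphic_density_skelDist_explicit`).

## References

* K. Osterwalder, R. Schrader, *Axioms for Euclidean Green's functions II*, Comm. Math. Phys.
  42 (1975) 281–305, Thm. 4.1 (4.5), Ch. VI.1 (6.12)–(6.13). [OsterwalderSchraderCMP1975]
-/

noncomputable section

open MeasureTheory Set Filter Module Metric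
open _root_.Topology
open scoped InnerProductSpace RealInnerProductSpace SchwartzMap NNReal Real

namespace Literature.MathematicalPhysics.QuantumFieldTheory

open Literature.MathematicalPhysics.QuantumLattice (SchwingerFamily IsPositiveTimeMulti schwartzNorm)
open Literature.MathematicalPhysics.QuantumLattice.SchwingerFamily
open Literature.MathematicalPhysics.QuantumLattice.SchwingerFamily.OSSpace
open Literature.Analysis.FunctionSpaces.SchwartzAverage
open Literature.Analysis.Distribution
open Literature.Analysis.Complex

variable {d : ℕ}

/-! ### The unit constants with a free window -/

section Units

variable [NeZero d] {k : ℕ} (ξ : Fin (k + 1) → EuclideanSpace ℝ (Fin d)) (ê : Fin d → EuclideanSpace ℝ (Fin d)) {g : ℝ}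

variable (g) in
/-- The unit maximal slot bound with window `b`: `slotBmax b unitSlotC (2M)`. [folklore] -/
def unitSlotBmaxW (b : ℝ) (Cv : ℕ → ℝ) (M : ℕ) : ℝ := LogSlot.slotBmax b (unitSlotC ξ ê g Cv M) fun _ => M + M

/-- `unitSlotBmaxW ≥ 0`. [folklore] -/
theorem unitSlotBmaxW_nonneg (b : ℝ) {Cv : ℕ → ℝ} (hCv : ∀ n, 0 ≤ Cv n) (M : ℕ) : 0 ≤ unitSlotBmaxW ξ ê g b Cv M :=
  LogSlot.slotBmax_nonneg b (unitSlotC_nonneg ξ ê hCv M) _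

omit [NeZero d] in
/-- The unit tube constant with window `b`: `l1TubeBound (π/2) b 0 (K+1) 1 0 c`. [folklore] -/
def unitTubeConstW (b : ℝ) (K : ℕ) (c : ℝ) : ℝ := l1TubeBound (π / 2) b 0 (K + 1) (fun _ => 1) (fun _ => 0) c

omit [NeZero d] in
/-- `unitTubeConstW ≥ 0`. [folklore] -/
theorem unitTubeConstW_nonneg (b : ℝ) (K : ℕ) (c : ℝ) : 0 ≤ unitTubeConstW b K c := l1TubeBound_one_nonneg _ _ _ _ _ _

omit [NeZero d] in
/-- Each slot bound at Gaussian profiles is at most the maximal one. [folklore] -/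
theorem LogSlot.slotB_gauss_le_slotBmax {K : ℕ} (b : ℝ) (C : Fin (K + 1) → ℝ) (N : Fin (K + 1) → ℕ) (i : Fin (K + 1)) :
    LogSlot.slotB i b (C i) (N i) (fun _ (s : ℝ) => Complex.exp (-(b : ℂ) * (s : ℂ) ^ 2)) ≤ LogSlot.slotBmax b C N :=
  Finset.le_sup' (fun i => LogSlot.slotB i b (C i) (N i) fun _ (s : ℝ) => Complex.exp (-(b : ℂ) * (s : ℂ) ^ 2))
    (Finset.mem_univ i)

end Units

/-! ### The logarithmic-slot engine for the skeleton with a free window -/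

section SlotData

variable [NeZero d] (𝔖 : SchwingerFamily (EuclideanSpace ℝ (Fin d)))
  (hE2 : 𝔖.IsOSReflectionPositive) {k : ℕ}
  (ξ : Fin (k + 1) → EuclideanSpace ℝ (Fin d)) (ê : Fin d → EuclideanSpace ℝ (Fin d)) {g r₀ : ℝ}

/-- **The logarithmic-slot engine for the profile-smeared skeleton, explicit form**: for
`F = l1TubeExtension b (logT 𝒮ᵣ b)` (`𝒮ᵣ` the reindexed skeleton), holomorphy on `{∑ |Im zⱼ| < π/2}`,
the bound `‖F z‖ ≤ (∏ⱼ |φⱼ|_M) · unitSlotBmax · unitTubeConst c` on `{∑ |Im zⱼ| ≤ c}`, and the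
real-point identity `F(x) = e^{-2∑xⱼ²} 𝒮ᵣ(eˣ)`. [cite: OsterwalderSchraderCMP1975, Ch. V (5.7)–(5.8), Ch. VI.1 (6.12)–(6.13)] -/
theorem l1TubeExtension_logT_skelSVr_specW {b : ℝ} (hb : 0 < b) (hE1 : 𝔖.IsEuclideanCovariant)
    (hê1 : ∀ μ, ‖ê μ‖ = 1) (hêê : ∀ μ ν, 0 ≤ ⟪ê μ, ê ν⟫) (hξ : ∀ μ i', g ≤ ⟪ê μ, ξ i'⟫)
    (hg : 2 * r₀ < g) (hr₀ : 0 ≤ r₀) (φ : Fin (k + 2) → 𝓢(EuclideanSpace ℝ (Fin d), ℂ))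
    (hφ : ∀ j, tsupport (φ j : EuclideanSpace ℝ (Fin d) → ℂ) ⊆ Metric.closedBall 0 r₀)
    {s : ℕ} {Cv : ℕ → ℝ} (hCv : ∀ n, 0 ≤ Cv n)
    (hv : ∀ (n : ℕ) (K : 𝓢((Fin n → EuclideanSpace ℝ (Fin d)), ℂ)) (hK : IsPositiveTimeMulti K),
      ‖ι 𝔖 hE2 (δ 𝔖 hE2 (mkGen K hK))‖ ≤ Cv n * schwartzNorm ((n + n) * s) K)
    {M : ℕ} (hM : (k + 1 + (k + 1)) * s ≤ M)
    {s₀ : ℕ} {C₀ : ℝ} (hC₀ : 0 ≤ C₀)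
    (hσ : ∀ F : 𝓢((Fin (k + 2) → EuclideanSpace ℝ (Fin d)), ℂ), ‖𝔖 (k + 2) F‖ ≤ C₀ * schwartzNorm s₀ F) :
    DifferentiableOn ℂ (l1TubeExtension b (LogSlot.logT (skelSVr 𝔖 φ ξ ê) b))
        {z : Fin (slotK k d + 1) → ℂ | ∑ j, |(z j).im| < π / 2} ∧
      (∀ c : ℝ, c < π / 2 → ∀ z : Fin (slotK k d + 1) → ℂ, ∑ j, |(z j).im| ≤ c →
        ‖l1TubeExtension b (LogSlot.logT (skelSVr 𝔖 φ ξ ê) b) z‖ ≤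
          profProd M φ * unitSlotBmaxW ξ ê g b Cv M * unitTubeConstW b (slotK k d) c) ∧
      ∀ x : Fin (slotK k d + 1) → ℝ, l1TubeExtension b (LogSlot.logT (skelSVr 𝔖 φ ξ ê) b) (fun j => (x j : ℂ)) =
        LogSlot.logDensity (skelSVr 𝔖 φ ξ ê) b x := by
  have hSc : Continuous (skelSVr 𝔖 φ ξ ê) := (continuous_skelSV 𝔖 φ ξ ê).comp continuous_reindexV
  obtain ⟨hF, hK, -, -, hreal⟩ := LogSlot.l1TubeExtension_logT_spec (skelSVr 𝔖 φ ξ ê)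
    (slotEr 𝔖 hE1 hE2 φ ξ ê hφ hê1 hêê hξ hg hr₀) hb hSc (norm_skelSVr_le 𝔖 ξ ê φ hC₀ hσ)
    (continuous_slotEr_left 𝔖 hE1 hE2 ξ ê hê1 hêê hξ hg hr₀ φ hφ)
    (differentiableOn_slotEr 𝔖 hE1 hE2 ξ ê hê1 hêê hξ hg hr₀ φ hφ)
    (fun j => profProd M φ * unitSlotC ξ ê g Cv M j) (fun _ => M + M)
    (fun j => mul_nonneg (profProd_nonneg M φ) (unitSlotC_nonneg ξ ê hCv M j))
    (fun j v' _ hτ => norm_slotEr_le 𝔖 hE1 hE2 ξ ê hê1 hêê hξ hg hr₀ φ hφ hCv hv hM j v' hτ)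
    (slotEr_ofReal 𝔖 hE1 hE2 ξ ê hê1 hêê hξ hg hr₀ φ hφ)
  refine ⟨hF, fun c hc z hz => (hK c hc z hz).trans ?_, hreal⟩
  rw [l1TubeBound_const_mul]
  have hL := l1TubeBound_one_nonneg (π / 2) b 0 (slotK k d + 1) (fun _ => 0) c
  have hB := LogSlot.slotBmax_const_mul_le (profProd_nonneg M φ) b (unitSlotC ξ ê g Cv M) (fun _ => M + M)
  unfold unitSlotBmaxW unitTubeConstW
  calc LogSlot.slotBmax b (fun j => profProd M φ * unitSlotC ξ ê g Cv M j) (fun _ => M + M) *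
        l1TubeBound (π / 2) b 0 (slotK k d + 1) (fun _ => 1) (fun _ => 0) c
      ≤ (profProd M φ * LogSlot.slotBmax b (unitSlotC ξ ê g Cv M) fun _ => M + M) *
        l1TubeBound (π / 2) b 0 (slotK k d + 1) (fun _ => 1) (fun _ => 0) c :=
        mul_le_mul_of_nonneg_right hB hL
    _ = _ := by ring

/-- The slot representations of the functional with the explicit constants (hypothesis `hT` of the
flat tube theorems, for the family continuity). [folklore] -/
theorem logT_skelSVr_slotW {b : ℝ} (hb : 0 < b) (hE1 : 𝔖.IsEuclideanCovariant)
    (hê1 : ∀ μ, ‖ê μ‖ = 1) (hêê : ∀ μ ν, 0 ≤ ⟪ê μ, ê ν⟫) (hξ : ∀ μ i', g ≤ ⟪ê μ, ξ i'⟫)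
    (hg : 2 * r₀ < g) (hr₀ : 0 ≤ r₀) (φ : Fin (k + 2) → 𝓢(EuclideanSpace ℝ (Fin d), ℂ))
    (hφ : ∀ j, tsupport (φ j : EuclideanSpace ℝ (Fin d) → ℂ) ⊆ Metric.closedBall 0 r₀)
    {s : ℕ} {Cv : ℕ → ℝ} (hCv : ∀ n, 0 ≤ Cv n)
    (hv : ∀ (n : ℕ) (K : 𝓢((Fin n → EuclideanSpace ℝ (Fin d)), ℂ)) (hK : IsPositiveTimeMulti K),
      ‖ι 𝔖 hE2 (δ 𝔖 hE2 (mkGen K hK))‖ ≤ Cv n * schwartzNorm ((n + n) * s) K)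
    {M : ℕ} (hM : (k + 1 + (k + 1)) * s ≤ M)
    {s₀ : ℕ} {C₀ : ℝ} (hC₀ : 0 ≤ C₀)
    (hσ : ∀ F : 𝓢((Fin (k + 2) → EuclideanSpace ℝ (Fin d)), ℂ), ‖𝔖 (k + 2) F‖ ≤ C₀ * schwartzNorm s₀ F)
    (i : Fin (slotK k d + 1)) (θ : Fin (slotK k d + 1) → 𝓢(ℝ, ℂ)) :
    ∃ g' : ℂ → ℂ, DifferentiableOn ℂ g' {z : ℂ | |z.im| < π / 2} ∧
      (∀ c : ℝ, c < π / 2 → ∀ z : ℂ, |z.im| ≤ c →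
        ‖g' z‖ ≤ LogSlot.slotB i b (profProd M φ * unitSlotC ξ ê g Cv M i) (M + M) (fun j => ⇑(θ j)) *
          Real.exp (0 * |z.re|)) ∧
      ∀ ϑ : 𝓢(ℝ, ℂ), LogSlot.logT (skelSVr 𝔖 φ ξ ê) b (Function.update (fun j => ⇑(θ j)) i ϑ) =
        ∫ s : ℝ, g' s * Complex.exp (-(b : ℂ) * (s : ℂ) ^ 2) * ϑ s :=
  LogSlot.logT_slot (skelSVr 𝔖 φ ξ ê) (slotEr 𝔖 hE1 hE2 φ ξ ê hφ hê1 hêê hξ hg hr₀) hb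
    ((continuous_skelSV 𝔖 φ ξ ê).comp continuous_reindexV) (norm_skelSVr_le 𝔖 ξ ê φ hC₀ hσ)
    (continuous_slotEr_left 𝔖 hE1 hE2 ξ ê hê1 hêê hξ hg hr₀ φ hφ)
    (differentiableOn_slotEr 𝔖 hE1 hE2 ξ ê hê1 hêê hξ hg hr₀ φ hφ)
    (slotEr_ofReal 𝔖 hE1 hE2 ξ ê hê1 hêê hξ hg hr₀ φ hφ) i
    (mul_nonneg (profProd_nonneg M φ) (unitSlotC_nonneg ξ ê hCv M i))
    (fun v' _ hτ => norm_slotEr_le 𝔖 hE1 hE2 ξ ê hê1 hêê hξ hg hr₀ φ hφ hCv hv hM i v' hτ) θ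

end SlotData

/-! ### The regularised densities with a free window -/

section Regularised

variable [NeZero d] (𝔖 : SchwingerFamily (EuclideanSpace ℝ (Fin d)))
  (hE2 : 𝔖.IsOSReflectionPositive) {k : ℕ}
  (ξ : Fin (k + 1) → EuclideanSpace ℝ (Fin d)) (ê : Fin d → EuclideanSpace ℝ (Fin d)) {g r₀ : ℝ}

/-- **The explicit holomorphic extension of the regularised skeleton in the logarithmic variables**:
`F_w = l1TubeExtension 1 (logT 𝒮ᵣ[κ_w] 1)`. [cite: OsterwalderSchraderCMP1975, Ch. V.1 (5.8), Ch. VI.1 (6.8)] -/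
def regFW (b : ℝ) (κ : Fin (k + 2) → 𝓢(EuclideanSpace ℝ (Fin d), ℂ)) (w : ℝ) : (Fin (slotK k d + 1) → ℂ) → ℂ :=
  l1TubeExtension b (LogSlot.logT (skelSVr 𝔖 (scaledProf κ w) ξ ê) b)

/-- **The holomorphic densities of the regularised skeleton distribution** (hypothesis `G` of the
analytic deconvolution lemma): `G_{(c, κ)}(w, z) = c · (sector extension of F_w)(tail z)`. [cite: OsterwalderSchraderCMP1975, Ch. VI.1 (6.8)–(6.9)] -/
def regGW (b : ℝ) (a : ℂ × (Fin (k + 2) → 𝓢(EuclideanSpace ℝ (Fin d), ℂ))) (w : ℝ) (z : Fin (k + 2) × Fin d → ℂ) : ℂ :=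
  a.1 * logSectorExt b (regFW 𝔖 ξ ê b a.2 w) (tailC z)

variable (g) in
/-- **The constants of the densities** (hypothesis `C` of the analytic deconvolution lemma). [folklore] -/
def regCW (b : ℝ) (Cv : ℕ → ℝ) (M : ℕ) (x₀ : EuclideanSpace ℝ (Fin (k + 2) × Fin d)) (r : ℝ)
    (a : ℂ × (Fin (k + 2) → 𝓢(EuclideanSpace ℝ (Fin d), ℂ))) : ℝ :=
  ‖a.1‖ * (Real.exp (2 * |b| * (slotK k d + 1) * (logRadius (tailR x₀) r + π / 4) ^ 2) *
    (profProd M a.2 * unitSlotBmaxW ξ ê g b Cv M * unitTubeConstW b (slotK k d) (π / 4)))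

/-- `regC ≥ 0`. [folklore] -/
theorem regCW_nonneg (b : ℝ) {Cv : ℕ → ℝ} (hCv : ∀ n, 0 ≤ Cv n) (M : ℕ) (x₀ : EuclideanSpace ℝ (Fin (k + 2) × Fin d)) (r : ℝ)
    (a : ℂ × (Fin (k + 2) → 𝓢(EuclideanSpace ℝ (Fin d), ℂ))) : 0 ≤ regCW ξ ê g b Cv M x₀ r a := by
  unfold regCW
  have h1 := profProd_nonneg M a.2
  have h2 := unitSlotBmaxW_nonneg ξ ê (g := g) b hCv M
  have h3 := unitTubeConstW_nonneg b (slotK k d) (π / 4)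
  positivity

variable {b : ℝ} (hb : 0 < b) (hE1 : 𝔖.IsEuclideanCovariant)
  (hê1 : ∀ μ, ‖ê μ‖ = 1) (hêê : ∀ μ ν, 0 ≤ ⟪ê μ, ê ν⟫) (hξ : ∀ μ i', g ≤ ⟪ê μ, ξ i'⟫)
  (hg : 2 * r₀ < g) (hr₀ : 0 ≤ r₀)
  {s : ℕ} {Cv : ℕ → ℝ} (hCv : ∀ n, 0 ≤ Cv n)
  (hv : ∀ (n : ℕ) (K : 𝓢((Fin n → EuclideanSpace ℝ (Fin d)), ℂ)) (hK : IsPositiveTimeMulti K),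
    ‖ι 𝔖 hE2 (δ 𝔖 hE2 (mkGen K hK))‖ ≤ Cv n * schwartzNorm ((n + n) * s) K)
  {M : ℕ} (hM : (k + 1 + (k + 1)) * s ≤ M)
  {s₀ : ℕ} {C₀ : ℝ} (hC₀ : 0 ≤ C₀)
  (hσ : ∀ F : 𝓢((Fin (k + 2) → EuclideanSpace ℝ (Fin d)), ℂ), ‖𝔖 (k + 2) F‖ ≤ C₀ * schwartzNorm s₀ F)

include hb hE1 hê1 hêê hξ hg hr₀ hCv hv hM hC₀ hσ

/-- **The regularised extension**: holomorphy on the tube, the bound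
`‖F_w ζ‖ ≤ w^{-(d+M)(k+2)} (∏ⱼ |κⱼ|_M) unitSlotBmax unitTubeConst(π/4)` on `{∑ |Im ζⱼ| ≤ π/4}`, and the
real-point identity. [cite: OsterwalderSchraderCMP1975, Ch. VI.1 (6.12)–(6.13)] -/
theorem regFW_spec (κ : Fin (k + 2) → 𝓢(EuclideanSpace ℝ (Fin d), ℂ))
    (hκ : ∀ j, tsupport (κ j : EuclideanSpace ℝ (Fin d) → ℂ) ⊆ Metric.closedBall 0 r₀) {w : ℝ} (hw : w ∈ Ioc (0 : ℝ) 1) :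
    DifferentiableOn ℂ (regFW 𝔖 ξ ê b κ w) {z : Fin (slotK k d + 1) → ℂ | ∑ j, |(z j).im| < π / 2} ∧
      (∀ ζ : Fin (slotK k d + 1) → ℂ, ∑ j, |(ζ j).im| ≤ π / 4 →
        ‖regFW 𝔖 ξ ê b κ w ζ‖ ≤ (w ^ ((d + M) * (k + 2)))⁻¹ * profProd M κ * unitSlotBmaxW ξ ê g b Cv M *
          unitTubeConstW b (slotK k d) (π / 4)) ∧
      ∀ x : Fin (slotK k d + 1) → ℝ, regFW 𝔖 ξ ê b κ w (fun j => (x j : ℂ)) =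
        Complex.exp (-(2 * b : ℂ) * ∑ j, (x j : ℂ) ^ 2) *
          skelSVr 𝔖 (scaledProf κ w) ξ ê (fun j => Real.exp (x j)) := by
  obtain ⟨hF, hK, hreal⟩ := l1TubeExtension_logT_skelSVr_specW 𝔖 hE2 ξ ê hb hE1 hê1 hêê hξ hg hr₀ (scaledProf κ w)
    (tsupport_scaledProf_subset hr₀ hκ hw) hCv hv hM hC₀ hσ
  refine ⟨hF, fun ζ hζ => (hK (π / 4) (by linarith [Real.pi_pos]) ζ hζ).trans ?_, fun x => ?_⟩
  · have h1 := profProd_scaledProf_le M κ hw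
    have h2 := unitSlotBmaxW_nonneg ξ ê (g := g) b hCv M
    have h3 := unitTubeConstW_nonneg b (slotK k d) (π / 4)
    have h4 : 0 ≤ (w ^ ((d + M) * (k + 2)))⁻¹ * profProd M κ := mul_nonneg (by have := hw.1; positivity) (profProd_nonneg M κ)
    gcongr
  · rw [regFW, hreal x]
    rfl

/-- **The bound of the densities** (hypothesis `hbd`): `‖G_a(w, z)‖ ≤ regC a · w^{-(d+M)(k+2)}` on the
ball of radius `r` about a real point whose tail coordinates dominate `r`. [cite: OsterwalderSchraderCMP1975, Ch. VI.1 (6.13)] -/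
theorem norm_regGW_le (a : ℂ × (Fin (k + 2) → 𝓢(EuclideanSpace ℝ (Fin d), ℂ)))
    (hκ : ∀ j, tsupport (a.2 j : EuclideanSpace ℝ (Fin d) → ℂ) ⊆ Metric.closedBall 0 r₀) {w : ℝ} (hw : w ∈ Ioc (0 : ℝ) 1)
    (x₀ : EuclideanSpace ℝ (Fin (k + 2) × Fin d)) {r : ℝ} (hr : 0 < r)
    (hrx : ∀ j, r ≤ tailR x₀ j * Real.sin (π / (4 * (slotK k d + 1))))
    {z : Fin (k + 2) × Fin d → ℂ} (hz : z ∈ ball (eRealPt x₀) r) :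
    ‖regGW 𝔖 ξ ê b a w z‖ ≤ regCW ξ ê g b Cv M x₀ r a * (w ^ ((d + M) * (k + 2)))⁻¹ := by
  obtain ⟨-, hK, -⟩ := regFW_spec 𝔖 hE2 ξ ê hb hE1 hê1 hêê hξ hg hr₀ hCv hv hM hC₀ hσ a.2 hκ hw
  have hρm : r < Finset.univ.inf' Finset.univ_nonempty (tailR x₀) :=
    (Finset.lt_inf'_iff _).2 fun j _ => (tailR_centre_pos hr hrx j).2
  have hw' : tailC z ∈ ball (fun j => ((tailR x₀ j : ℝ) : ℂ)) r := by
    rw [← tailC_eRealPt]; exact tailC_mem_ball hz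
  have h := norm_logSectorExt_le b hK hrx hρm hw'
  unfold regGW regCW
  rw [norm_mul]
  refine (mul_le_mul_of_nonneg_left h (norm_nonneg _)).trans (le_of_eq ?_)
  ring

/-- **Holomorphy of the densities** (hypothesis `hdiff`). [folklore] -/
theorem differentiableOn_regGW (a : ℂ × (Fin (k + 2) → 𝓢(EuclideanSpace ℝ (Fin d), ℂ)))
    (hκ : ∀ j, tsupport (a.2 j : EuclideanSpace ℝ (Fin d) → ℂ) ⊆ Metric.closedBall 0 r₀) {w : ℝ} (hw : w ∈ Ioc (0 : ℝ) 1)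
    (x₀ : EuclideanSpace ℝ (Fin (k + 2) × Fin d)) {r : ℝ}
    (hrx : ∀ j, r ≤ tailR x₀ j * Real.sin (π / (4 * (slotK k d + 1)))) :
    DifferentiableOn ℂ (regGW 𝔖 ξ ê b a w) (ball (eRealPt x₀) r) := by
  obtain ⟨hF, -, -⟩ := regFW_spec 𝔖 hE2 ξ ê hb hE1 hê1 hêê hξ hg hr₀ hCv hv hM hC₀ hσ a.2 hκ hw
  have hsec : MapsTo tailC (ball (eRealPt x₀) r) (sectorRegion (slotK k d) (π / 2)) := fun z hz => by
    have h1 := tailC_mem_ball hz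
    rw [tailC_eRealPt] at h1
    have h2 := ball_subset_sectorRegion (K := slotK k d) (u := tailR x₀) hrx h1
    exact ⟨h2.1, h2.2.trans_le (by linarith [Real.pi_pos])⟩
  unfold regGW
  exact (differentiableOn_const _).mul ((differentiableOn_logSectorExt b hF).comp differentiable_tailC.differentiableOn hsec)

/-- **The densities represent the regularised skeleton distribution** (hypothesis `hdens`): for `ψ`
supported in the real ball,
`T(K_{(N_a)_w} ψ) = ∫ G_a(w, x) ψ(x) dx`. [cite: OsterwalderSchraderCMP1975, Ch. VI.1 (6.8)] -/
theorem skelDist_scaleKernel_skelFamilyW (hli : LinearIndependent ℝ ê)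
    (a : ℂ × (Fin (k + 2) → 𝓢(EuclideanSpace ℝ (Fin d), ℂ)))
    (hκ : ∀ j, tsupport (a.2 j : EuclideanSpace ℝ (Fin d) → ℂ) ⊆ Metric.closedBall 0 r₀) {w : ℝ} (hw : w ∈ Ioc (0 : ℝ) 1)
    (x₀ : EuclideanSpace ℝ (Fin (k + 2) × Fin d)) {r : ℝ} (hr : 0 < r)
    (hrx : ∀ j, r ≤ tailR x₀ j * Real.sin (π / (4 * (slotK k d + 1))))
    (ψ : 𝓢(EuclideanSpace ℝ (Fin (k + 2) × Fin d), ℂ))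
    (hψ : tsupport (ψ : EuclideanSpace ℝ (Fin (k + 2) × Fin d) → ℂ) ⊆ Metric.ball x₀ r) :
    skelDist 𝔖 ξ ê hli (translationAverage (ContinuousLinearMap.id ℝ _) (scaleKernel w (skelFamily ê hli a)) ψ) =
      ∫ x, regGW 𝔖 ξ ê b a w (eRealPt x) * ψ x := by
  obtain ⟨c, κ⟩ := a
  obtain ⟨-, -, hreal⟩ := regFW_spec 𝔖 hE2 ξ ê hb hE1 hê1 hêê hξ hg hr₀ hCv hv hM hC₀ hσ κ hκ hw
  have hρ : ∀ j, r ≤ tailR x₀ j := fun j => (tailR_centre_pos hr hrx j).2.le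
  rw [scaleKernel_skelFamily, show skelFamily ê hli (c, fun j => scaleKernel w (κ j)) =
      c • skelKernel ê hli (SchwartzMap.tensorFin (k + 2) (scaledProf κ w)) from rfl,
    translationAverage_id_smul_kernel, map_smul, skelDist_translationAverage_tensor 𝔖 ξ ê hli hE1, smul_eq_mul,
    ← integral_const_mul]
  refine integral_congr_ae (Eventually.of_forall fun x => ?_)
  by_cases hx : x ∈ tsupport (ψ : EuclideanSpace ℝ (Fin (k + 2) × Fin d) → ℂ)
  · have hpos : ∀ j, 0 < tailR x j := tailR_pos_of_mem_ball (hψ hx) hρ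
    simp only [regGW]
    rw [tailC_eRealPt, logSectorExt_ofReal b hreal hpos, skelSVr, reindexV_tailR]
    ring
  · simp only [image_eq_zero_of_notMem_tsupport hx, mul_zero, zero_mul]

/-- **Joint continuity of the densities in the width and the point** (hypothesis `hcont`): on every
`[ε, 1]` the slot constants are uniform, so the flat-tube family theorem
(`continuousOn_l1TubeExtension_family`, fed through the clamped width `max ε (min w 1)`) and the
continuity of the sector extension give continuity on `[ε, 1] × ball`; as `ε → 0` this exhausts
`(0, 1] × ball`. [folklore] -/
theorem continuousOn_regGW (a : ℂ × (Fin (k + 2) → 𝓢(EuclideanSpace ℝ (Fin d), ℂ)))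
    (hκ : ∀ j, tsupport (a.2 j : EuclideanSpace ℝ (Fin d) → ℂ) ⊆ Metric.closedBall 0 r₀)
    (x₀ : EuclideanSpace ℝ (Fin (k + 2) × Fin d)) {r : ℝ}
    (hrx : ∀ j, r ≤ tailR x₀ j * Real.sin (π / (4 * (slotK k d + 1)))) :
    ContinuousOn (fun q : ℝ × (Fin (k + 2) × Fin d → ℂ) => regGW 𝔖 ξ ê b a q.1 q.2) (Ioc 0 1 ×ˢ ball (eRealPt x₀) r) := by
  obtain ⟨c₀, κ⟩ := a
  -- Step 1: joint continuity of `(w, ζ) ↦ F_w ζ` on `[ε, 1] × tube`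
  have hstep : ∀ ε : ℝ, 0 < ε → ε < 1 →
      ContinuousOn (fun q : ℝ × (Fin (slotK k d + 1) → ℂ) => regFW 𝔖 ξ ê b κ q.1 q.2)
        (Icc ε 1 ×ˢ {z : Fin (slotK k d + 1) → ℂ | ∑ j, |(z j).im| < π / 2}) := by
    intro ε hε hε1
    set wc : ℝ → ℝ := fun ω => max ε (min ω 1) with hwc
    have hwc_mem : ∀ ω, wc ω ∈ Ioc (0 : ℝ) 1 := fun ω =>
      ⟨hε.trans_le (le_max_left _ _), max_le hε1.le (min_le_right _ _)⟩
    have hwc_ge : ∀ ω, ε ≤ wc ω := fun ω => le_max_left _ _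
    have hwc_cont : Continuous wc := continuous_const.max (continuous_id.min continuous_const)
    have hwc_id : ∀ ω ∈ Icc ε 1, wc ω = ω := fun ω hω => by
      show max ε (min ω 1) = ω
      rw [min_eq_left hω.2, max_eq_right hω.1]
    have hφs : ∀ ω j, tsupport (scaledProf κ (wc ω) j : EuclideanSpace ℝ (Fin d) → ℂ) ⊆ Metric.closedBall 0 r₀ :=
      fun ω => tsupport_scaledProf_subset hr₀ hκ (hwc_mem ω)
    have hfam := continuousOn_l1TubeExtension_family (a := π / 2) (κ := 0) (b := b) (by positivity) hb
      (fun ω => LogSlot.logT (skelSVr 𝔖 (scaledProf κ (wc ω)) ξ ê) b)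
      (fun ω i θ _ => LogSlot.slotB i b (profProd M (scaledProf κ (wc ω)) * unitSlotC ξ ê g Cv M i) (M + M) θ)
      (fun ω i θ => logT_skelSVr_slotW 𝔖 hE2 ξ ê hb hE1 hê1 hêê hξ hg hr₀ (scaledProf κ (wc ω)) (hφs ω) hCv hv hM hC₀ hσ i θ)
      (fun _ => (ε ^ ((d + M) * (k + 2)))⁻¹ * profProd M κ * unitSlotBmaxW ξ ê g b Cv M) (fun _ => 0)
      (fun c _ ω i p => by
        rw [LogSlot.slotB_gaussMod_eq, pow_zero, mul_one]
        refine le_trans (LogSlot.slotB_gauss_le_slotBmax b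
          (fun i => profProd M (scaledProf κ (wc ω)) * unitSlotC ξ ê g Cv M i) (fun _ => M + M) i) ?_
        refine (LogSlot.slotBmax_const_mul_le (profProd_nonneg M _) b (unitSlotC ξ ê g Cv M) fun _ => M + M).trans ?_
        exact mul_le_mul_of_nonneg_right (profProd_scaledProf_le_of_le M κ hε (hwc_ge ω) (hwc_mem ω).2)
          (unitSlotBmaxW_nonneg ξ ê b hCv M))
      (fun p => by
        choose θ hθ using fun j => exists_schwartzMap_gaussMod hb (p j)
        have hθfun : (fun j (s : ℝ) => Complex.exp (-(b : ℂ) * (s : ℂ) ^ 2) *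
            Complex.exp (↑(-2 * π * s * p j) * Complex.I)) = fun j => ⇑(θ j) :=
          funext fun j => funext fun s => (hθ j s).symm
        rw [hθfun]
        have h0 := skelQ_nonneg ξ ê s₀
        have hc := LogSlot.continuousOn_logT_param (Ω := ℝ) (T := univ)
          (S := fun ω => skelSVr 𝔖 (scaledProf κ (wc ω)) ξ ê) hb
          (fun ω _ => (continuous_skelSV 𝔖 _ ξ ê).comp continuous_reindexV)
          (C := C₀ * skelQ ξ ê s₀ * ((ε ^ ((d + s₀) * (k + 2)))⁻¹ * profProd s₀ κ)) (N := s₀)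
          (fun ω _ u => (norm_skelSVr_le 𝔖 ξ ê _ hC₀ hσ u).trans (by
            have h1 := profProd_scaledProf_le_of_le s₀ κ hε (hwc_ge ω) (hwc_mem ω).2
            gcongr))
          (fun u => ((continuousOn_skelSV_scaleKernel 𝔖 ξ ê κ (reindexV u)).comp_continuous hwc_cont
            fun ω => (hwc_mem ω).1).continuousOn) θ
        exact continuousOn_univ.1 hc)
    refine (hfam.mono (prod_mono (subset_univ _) Subset.rfl)).congr fun q hq => ?_
    show regFW 𝔖 ξ ê b κ q.1 q.2 = l1TubeExtension b (LogSlot.logT (skelSVr 𝔖 (scaledProf κ (wc q.1)) ξ ê) b) q.2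
    rw [hwc_id q.1 (mem_prod.1 hq).1]
    rfl
  -- Step 2: joint continuity of `G` on `[ε, 1] × ball`
  have hstep2 : ∀ ε : ℝ, 0 < ε → ε < 1 →
      ContinuousOn (fun q : ℝ × (Fin (k + 2) × Fin d → ℂ) => regGW 𝔖 ξ ê b (c₀, κ) q.1 q.2)
        (Icc ε 1 ×ˢ ball (eRealPt x₀) r) := by
    intro ε hε hε1
    have hls := continuousOn_logSectorExt_param (Ω := ℝ) b (F := regFW 𝔖 ξ ê b κ) (c := π / 2) (T := Icc ε 1)
      (hstep ε hε hε1)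
    have hmaps : MapsTo (fun q : ℝ × (Fin (k + 2) × Fin d → ℂ) => (q.1, tailC q.2)) (Icc ε 1 ×ˢ ball (eRealPt x₀) r)
        (Icc ε 1 ×ˢ sectorRegion (slotK k d) (π / 2)) := fun q hq => by
      refine ⟨(mem_prod.1 hq).1, ?_⟩
      have h1 := tailC_mem_ball (mem_prod.1 hq).2
      rw [tailC_eRealPt] at h1
      have h2 := ball_subset_sectorRegion (K := slotK k d) (u := tailR x₀) hrx h1
      exact ⟨h2.1, h2.2.trans_le (by linarith [Real.pi_pos])⟩
    have hcomp := hls.comp (continuous_fst.prodMk (continuous_tailC.comp continuous_snd)).continuousOn hmaps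
    exact continuousOn_const.mul hcomp
  -- Step 3: exhaust `(0, 1]`
  rintro ⟨w, z⟩ hq
  obtain ⟨⟨hw0, hw1⟩, hz⟩ := mem_prod.1 hq
  have h := (hstep2 (w / 2) (by linarith) (by linarith)) (w, z) (mk_mem_prod ⟨by linarith, hw1⟩ hz)
  refine h.mono_of_mem_nhdsWithin (mem_nhdsWithin.2 ⟨Ioi (w / 2) ×ˢ univ, isOpen_Ioi.prod isOpen_univ,
    mk_mem_prod (show w / 2 < w by linarith) (mem_univ _), ?_⟩)
  rintro q ⟨hq1, hq2⟩
  exact mk_mem_prod ⟨le_of_lt (mem_prod.1 hq1).1, (mem_prod.1 hq2).1.2⟩ (mem_prod.1 hq2).2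

end Regularised

/-! ### The explicit form of the main theorem -/

section Main

variable [NeZero d] (𝔖 : SchwingerFamily (EuclideanSpace ℝ (Fin d))) (hE1 : 𝔖.IsEuclideanCovariant)
  (hE2 : 𝔖.IsOSReflectionPositive) {k : ℕ}
  (ξ : Fin (k + 1) → EuclideanSpace ℝ (Fin d)) (ê : Fin d → EuclideanSpace ℝ (Fin d)) (hli : LinearIndependent ℝ ê)
  {g r₀ b : ℝ} (hb : 0 < b) (hê1 : ∀ μ, ‖ê μ‖ = 1) (hêê : ∀ μ ν, 0 ≤ ⟪ê μ, ê ν⟫) (hξ : ∀ μ i', g ≤ ⟪ê μ, ξ i'⟫)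
  (hg : 2 * r₀ < g) (hr₀ : 0 < r₀)
  {s : ℕ} {Cv : ℕ → ℝ} (hCv : ∀ n, 0 ≤ Cv n)
  (hv : ∀ (n : ℕ) (K : 𝓢((Fin n → EuclideanSpace ℝ (Fin d)), ℂ)) (hK : IsPositiveTimeMulti K),
    ‖ι 𝔖 hE2 (δ 𝔖 hE2 (mkGen K hK))‖ ≤ Cv n * schwartzNorm ((n + n) * s) K)
  {M : ℕ} (hM : (k + 1 + (k + 1)) * s ≤ M)
  {s₀ : ℕ} {C₀ : ℝ} (hC₀ : 0 ≤ C₀)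
  (hσ : ∀ F : 𝓢((Fin (k + 2) → EuclideanSpace ℝ (Fin d)), ℂ), ‖𝔖 (k + 2) F‖ ≤ C₀ * schwartzNorm s₀ F)

include hE1 hb hê1 hêê hξ hg hr₀ hCv hv hM hC₀ hσ

/-- **The holomorphic density of the skeleton distribution, explicit form**: with the E0' data
`(s, Cv)`, the temperedness data `(s₀, C₀)` of `𝔖_{k+2}`, `M ≥ 2(k+1)s`, a window `b > 0` and an
admissible index `a₀` of mass one, the density `H` of `T = 𝔖_{k+2} ∘ skelPullback` on the ball
`B(x₀, r/2)` obeys the explicit bound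
`‖H z‖ ≤ deconvBound (admSplit ê hli) (regCW b …) a₀ ((d+M)(k+2)) r`. [cite: OsterwalderSchraderCMP1975, Thm. 4.1, Ch. VI.1 (6.5)–(6.13)] -/
theorem exists_holomorphic_density_skelDist_explicit (x₀ : EuclideanSpace ℝ (Fin (k + 2) × Fin d)) {r : ℝ} (hr : 0 < r)
    (hrx : ∀ j, r ≤ tailR x₀ j * Real.sin (π / (4 * (slotK k d + 1))))
    (a₀ : AdmIdx k d r₀) (hmass : ∫ U, skelFamily ê hli a₀.1 U = 1) :
    ∃ H : (Fin (k + 2) × Fin d → ℂ) → ℂ, DifferentiableOn ℂ H (ball (eRealPt x₀) (r / 2)) ∧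
      (∀ z ∈ ball (eRealPt x₀) (r / 2),
        ‖H z‖ ≤ deconvBound (admSplit ê hli) (fun a : AdmIdx k d r₀ => regCW ξ ê g b Cv M x₀ r a.1) a₀ ((d + M) * (k + 2)) r) ∧
      ∀ ψ : 𝓢(EuclideanSpace ℝ (Fin (k + 2) × Fin d), ℂ),
        tsupport (ψ : EuclideanSpace ℝ (Fin (k + 2) × Fin d) → ℂ) ⊆ Metric.ball x₀ (r / 2) →
          skelDist 𝔖 ξ ê hli ψ = ∫ x, H (eRealPt x) * ψ x := by
  classical
  set Nk : AdmIdx k d r₀ → 𝓢(EuclideanSpace ℝ (Fin (k + 2) × Fin d), ℂ) := fun a => skelFamily ê hli a.1 with hNk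
  have hX : ∀ (p : Fin (k + 2) × Fin d) (a : AdmIdx k d r₀),
      coordMul (EuclideanSpace.basisFun (Fin (k + 2) × Fin d) ℝ p) (Nk a) =
        Nk (admSplit ê hli p a).1 + Nk (admSplit ê hli p a).2 := fun p a => by
    simp only [hNk, admSplit]
    rw [show (EuclideanSpace.basisFun (Fin (k + 2) × Fin d) ℝ) p = EuclideanSpace.single p (1 : ℝ) by simp]
    exact coordMul_skelFamily ê hli p a.1
  have hsupp : ∀ a : AdmIdx k d r₀, tsupport (Nk a : EuclideanSpace ℝ (Fin (k + 2) × Fin d) → ℂ) ⊆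
      closedBall 0 (‖((posLinCLE (k := k) ê hli).symm).toContinuousLinearMap‖ * r₀) :=
    fun a => tsupport_skelFamily_subset ê hli hr₀.le a.1 a.2
  have hcont : ∀ a : AdmIdx k d r₀, ContinuousOn (fun q : ℝ × (Fin (k + 2) × Fin d → ℂ) => regGW 𝔖 ξ ê b a.1 q.1 q.2)
      (Ioc 0 1 ×ˢ ball (eRealPt x₀) r) := fun a =>
    continuousOn_regGW 𝔖 hE2 ξ ê hb hE1 hê1 hêê hξ hg hr₀.le hCv hv hM hC₀ hσ a.1 a.2 x₀ hrx
  have hdiff : ∀ a : AdmIdx k d r₀, ∀ w ∈ Ioc (0 : ℝ) 1, DifferentiableOn ℂ (regGW 𝔖 ξ ê b a.1 w) (ball (eRealPt x₀) r) :=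
    fun a w hw => differentiableOn_regGW 𝔖 hE2 ξ ê hb hE1 hê1 hêê hξ hg hr₀.le hCv hv hM hC₀ hσ a.1 a.2 hw x₀ hrx
  have hbd : ∀ a : AdmIdx k d r₀, ∀ w ∈ Ioc (0 : ℝ) 1, ∀ z ∈ ball (eRealPt x₀) r,
      ‖regGW 𝔖 ξ ê b a.1 w z‖ ≤ regCW ξ ê g b Cv M x₀ r a.1 * (w ^ ((d + M) * (k + 2)))⁻¹ :=
    fun a w hw z hz => norm_regGW_le 𝔖 hE2 ξ ê hb hE1 hê1 hêê hξ hg hr₀.le hCv hv hM hC₀ hσ a.1 a.2 hw x₀ hr hrx hz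
  have hC : ∀ a : AdmIdx k d r₀, 0 ≤ regCW ξ ê g b Cv M x₀ r a.1 := fun a => regCW_nonneg ξ ê b hCv _ x₀ r a.1
  have hdens : ∀ a : AdmIdx k d r₀, ∀ w ∈ Ioc (0 : ℝ) 1, ∀ ψ : 𝓢(EuclideanSpace ℝ (Fin (k + 2) × Fin d), ℂ),
      tsupport (ψ : EuclideanSpace ℝ (Fin (k + 2) × Fin d) → ℂ) ⊆ Metric.ball x₀ r →
        skelDist 𝔖 ξ ê hli (translationAverage (ContinuousLinearMap.id ℝ _) (scaleKernel w (Nk a)) ψ) =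
          ∫ x, regGW 𝔖 ξ ê b a.1 w (eRealPt x) * ψ x :=
    fun a w hw ψ hψ => skelDist_scaleKernel_skelFamilyW 𝔖 hE2 ξ ê hb hE1 hê1 hêê hξ hg hr₀.le hCv hv hM hC₀ hσ hli
      a.1 a.2 hw x₀ hr hrx ψ hψ
  exact exists_holomorphic_density_of_scaled_regularisations Nk (admSplit ê hli)
    (G := fun a => regGW 𝔖 ξ ê b a.1) (C := fun a => regCW ξ ê g b Cv M x₀ r a.1)
    hX hr hsupp hcont hdiff hbd hC hdens a₀ hmass

end Main

end Literature.MathematicalPhysics.QuantumFieldTheory
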